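import Literature.NumberTheory.LFunctions.ExplicitFormulaPsiChar
import Literature.NumberTheory.LFunctions.DirichletCharacterMulInvPrimitive
import Literature.NumberTheory.LFunctions.GeneralizedRH
import Literature.NumberTheory.DiophantineGeometry.NamedHypothesesRHProofs
import HarnessLib

/-!
# GRH for a Dirichlet `L`-function up to a given height: statement, count form, named facts

Topic `Literature/NumberTheory/LFunctions`; namespace `Literature.NumberTheory.LFunctions`.
The Dirichlet-`L` analogue of `Literature/NumberTheory/DiophantineGeometry/NamedHypotheses.lean`
(`RiemannHypothesisUpTo T`) and of its companion `NamedHypothesesProofs.lean` (the Turing-method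
reduction `N(T) ≤ N₀(T) → RiemannHypothesisUpTo T`). It fixes the statement shape by which
numerical verifications of the generalized Riemann hypothesis — Rumely (Math. Comp. 61, 1993),
Platt (Math. Comp. 85, 2016), Bennett–Martin–O'Bryant–Rechnitzer (Math. Comp. 90, 2021) — are
recorded in the tree, and carries two of them as named facts AS PRINTED.

## Contents

* `LFunctionRHUpTo χ T` — every zero `s` of `L(s, χ)` with `0 < Re s < 1` and `|Im s| ≤ T` has
  `Re s = 1/2`. Both signs of `Im s` are needed: for a complex character the zeros are not
  symmetric under conjugation (those of `L(s, χ̄)` are the conjugates of those of `L(s, χ)`), and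
  this is the convention of Platt 2016, Theorem 3.2 ("the number of zeros … with `|Im(s)| ≤ t₀`
  and `Re(s) ∈ (0, 1)`") and of Bennett et al., (1.1) (`N(T, χ) = #{ρ : |γ| ≤ T}`).
  Antitone in `T`; implied by `χ.RiemannHypothesis` (`GeneralizedRH.lean`), and `∀ T` gives it
  back; invariant under passage to the primitive character (`lfunctionRHUpTo_iff_primitiveCharacter`,
  from `DirichletCharacter.LFunction_eq_zero_iff_primitiveCharacter`: the extra Euler factors of
  an imprimitive character vanish only on `Re s = 0`).
* `GRHUpTo q T` — `LFunctionRHUpTo χ T` for every non-principal `χ` mod `q`.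
* Count form on the tree's objects of record (`lfunctionZeroBox χ T` of
  `ExplicitFormulaPsiChar.lean` — zeros with `0 < β < 1`, `|γ| ≤ T`; multiplicity
  `DirichletDisc.zeroOrder χ` of `DirichletLogDerivDisc.lean`): `lfunctionZeroCount χ T = N_χ(T)`,
  `lfunctionCriticalZeroCount χ T = N_{χ,0}(T)`, `lfunctionCriticalZeroCount_le` (`N₀ ≤ N`),
  **the Turing-method reduction** `LFunctionRHUpTo.of_zeroCount_le_criticalZeroCount`
  (`N_χ(T) ≤ N_{χ,0}(T) → LFunctionRHUpTo χ T`), `lfunctionRHUpTo_iff_criticalZeroCount_eq`, and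
  the certificate shape `LFunctionRHUpTo.of_count_sandwich` (`N_χ(T) ≤ n ≤ N_{χ,0}(T)`), all with
  real proofs (the argument of `NamedHypothesesProofs.lean` verbatim, in `ℕ`).
* Named facts (D-0014), statements AS PRINTED, not discharged: `platt2016_theorem71` (GRH for
  every primitive `χ` of modulus `1 < q ≤ 400 000` to height `plattHeight q`), `bmor2021_lemma61a`
  (GRH for primitive `χ` of conductor `1 < q < 935` to height `2(e⁶π − q)/q`), and the elementary
  consequence
  `grhUpTo_of_platt2016` (`GRHUpTo q (10⁸/q)` for all `q ≤ 400 000`, imprimitive characters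
  included; `GRHUpTo q 250` uniformly).

What is NOT here: the explicit formula / Weil functional with character (typed by the Weil-GRH
arm in its own file), certified evaluators of `L(s, χ)`, and any certificate checker; a
kernel-checkable certificate for small `(q, T)` would discharge an instance of
`LFunctionRHUpTo.of_count_sandwich` exactly as `ZetaArgumentCertificate.lean` does for `ζ`.

## References

* D. J. Platt, *Numerical computations concerning the GRH*, Math. Comp. 85 (2016), 3009–3027,
  Theorem 5.2 (p. 3013, zero count `N_χ(T)` over `|Im s| ≤ T`), Theorem 10.1 (p. 3026, GRH for
  primitive `χ` mod `q ≤ 400 000` to height `T(q)`), Theorem 10.2 (p. 3026, `L_χ(1/2) ≠ 0` for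
  primitive `χ` mod `q ≤ 2·10⁶`). NUMBERING NOTE (page-checked against the journal PDF,
  S0025-5718-2016-03077-X): the locators "Theorem 3.2 / 7.1 / 7.2" used in the declaration
  names `platt2016_theorem71`, `platt2016_theorem72` (this file) and
  `TuringDirichlet.platt2016_theorem32_corrected` and in the docstrings below are those of the
  arXiv version arXiv:1305.3087v1 (2013), whose §3 and §7 became §5 and §10 of the journal
  version; the statements are the same in both (journal Thm. 10.1 writes the height
  as `T`, arXiv Thm. 7.1 as `t₀`). Both locators are given in each `[cite:]` tag.
  [Platt2016GRH]
* M. A. Bennett, G. Martin, K. O'Bryant, A. Rechnitzer, *Counting zeros of Dirichlet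
  `L`-functions*, Math. Comp. 90 (2021), 1455–1482, (1.1) and Lemma 6.1.
  [BennettMartinOBryantRechnitzer2021]
* R. Rumely, *Numerical computations concerning the ERH*, Math. Comp. 61 (1993), 415–440.
  [Rumely1993ERH]
* H. L. Montgomery, R. C. Vaughan, *Multiplicative Number Theory I*, CUP 2007, §10.1 and
  Cor. 10.8 (non-trivial zeros; imprimitive characters). [MontgomeryVaughan2007]
-/

noncomputable section

open Complex Set

namespace Literature.NumberTheory.LFunctions

variable {q : ℕ} [NeZero q]

/-! ### GRH for `L(s, χ)` up to height `T` -/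

/-- **GRH for `L(s, χ)` up to height `T`**: every zero `s` of `DirichletCharacter.LFunction χ`
in the open critical strip `0 < Re s < 1` with `|Im s| ≤ T` lies on the critical line. This is
the statement established by a numerical verification "to height `T`" (Platt 2016, Thm. 3.2:
zeros "with `|Im(s)| ≤ t₀` and `Re(s) ∈ (0, 1)`"; Bennett et al. 2021, (1.1)); both signs of
`Im s` are required since the zeros of a complex character are not conjugation-symmetric.
[cite: Platt2016GRH, Theorem 3.2] -/
def LFunctionRHUpTo (χ : DirichletCharacter ℂ q) (T : ℝ) : Prop :=
  ∀ s : ℂ, χ.LFunction s = 0 → 0 < s.re → s.re < 1 → |s.im| ≤ T → s.re = 1 / 2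

/-- **GRH modulo `q` up to height `T`**: `LFunctionRHUpTo χ T` for every non-principal Dirichlet
character `χ` mod `q` (imprimitive ones included; cf. `lfunctionRHUpTo_iff_primitiveCharacter`).
[cite: Platt2016GRH, Theorem 10.1 p. 3026 (journal) = arXiv:1305.3087v1 Theorem 7.1] -/
def GRHUpTo (q : ℕ) [NeZero q] (T : ℝ) : Prop :=
  ∀ χ : DirichletCharacter ℂ q, χ ≠ 1 → LFunctionRHUpTo χ T

variable (χ : DirichletCharacter ℂ q)

/-- `LFunctionRHUpTo χ` is antitone in the height (immediate from the definition; a verification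
to height `t₀` is one to every smaller height). [cite: Platt2016GRH, Theorem 3.2] -/
theorem lfunctionRHUpTo_anti : Antitone (LFunctionRHUpTo χ) :=
  fun _ _ hTT' h s hs h0 h1 hT ↦ h s hs h0 h1 (hT.trans hTT')

variable {χ}

/-- Pointwise form: GRH for `χ` up to height `T` gives it up to any `T' ≤ T`.
[cite: Platt2016GRH, Theorem 3.2] -/
theorem LFunctionRHUpTo.mono_of_le {T T' : ℝ} (h : T' ≤ T) :
    LFunctionRHUpTo χ T → LFunctionRHUpTo χ T' :=
  lfunctionRHUpTo_anti χ h

/-- The strip-form Riemann hypothesis for `L(s, χ)` (`DirichletCharacter.RiemannHypothesis`,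
`GeneralizedRH.lean`; Montgomery–Vaughan §10.1 p. 333) gives `LFunctionRHUpTo χ T` for every `T`.
[cite: MontgomeryVaughan2007, §10.1 p. 333] -/
theorem LFunctionRHUpTo.of_riemannHypothesis (h : χ.RiemannHypothesis) (T : ℝ) :
    LFunctionRHUpTo χ T :=
  fun s hs h0 h1 _ ↦ h s hs h0 h1

/-- Conversely, GRH for `χ` up to every height is the strip-form Riemann hypothesis for
`L(s, χ)` (Montgomery–Vaughan §10.1 p. 333). [cite: MontgomeryVaughan2007, §10.1 p. 333] -/
theorem riemannHypothesis_of_forall_lfunctionRHUpTo (h : ∀ T, LFunctionRHUpTo χ T) :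
    χ.RiemannHypothesis :=
  fun s hs h0 h1 ↦ h |s.im| s hs h0 h1 le_rfl

/-- `χ.RiemannHypothesis ↔ ∀ T, LFunctionRHUpTo χ T` (Montgomery–Vaughan §10.1 p. 333).
[cite: MontgomeryVaughan2007, §10.1 p. 333] -/
theorem riemannHypothesis_iff_forall_lfunctionRHUpTo :
    χ.RiemannHypothesis ↔ ∀ T, LFunctionRHUpTo χ T :=
  ⟨LFunctionRHUpTo.of_riemannHypothesis, riemannHypothesis_of_forall_lfunctionRHUpTo⟩

/-- GRH mod `q` up to every height from the strip-form hypotheses of all characters mod `q`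
(Montgomery–Vaughan §10.1 p. 333). [cite: MontgomeryVaughan2007, §10.1 p. 333] -/
theorem grhUpTo_of_forall_riemannHypothesis (h : ∀ χ : DirichletCharacter ℂ q, χ.RiemannHypothesis)
    (T : ℝ) : GRHUpTo q T :=
  fun χ _ ↦ .of_riemannHypothesis (h χ) T

/-- **Reduction to the primitive character.** `L(s, χ)` and `L(s, χ⋆)` (`χ⋆ = χ.primitiveCharacter`)
have the same zeros in `0 < Re s < 1` (`DirichletCharacter.LFunction_eq_zero_iff_primitiveCharacter`:
the Euler factors `1 − χ⋆(p)p⁻ˢ`, `p ∣ q`, vanish only on `Re s = 0`; Montgomery–Vaughan (10.20)),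
so GRH up to height `T` for `χ` and for `χ⋆` are the same statement.
[cite: MontgomeryVaughan2007, §10.1 p. 333] -/
theorem lfunctionRHUpTo_iff_primitiveCharacter (χ : DirichletCharacter ℂ q) (T : ℝ) :
    LFunctionRHUpTo χ T ↔
      haveI : NeZero χ.conductor := ⟨χ.conductor_ne_zero⟩; LFunctionRHUpTo χ.primitiveCharacter T := by
  haveI : NeZero χ.conductor := ⟨χ.conductor_ne_zero⟩
  have hne : ∀ s : ℂ, s.re < 1 → s ≠ 1 := fun s h1 h ↦ by simp [h] at h1
  refine ⟨fun h s hs h0 h1 hT ↦ h s ?_ h0 h1 hT, fun h s hs h0 h1 hT ↦ h s ?_ h0 h1 hT⟩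
  · exact (χ.LFunction_eq_zero_iff_primitiveCharacter h0 (hne s h1)).2 hs
  · exact (χ.LFunction_eq_zero_iff_primitiveCharacter h0 (hne s h1)).1 hs

/-! ### The count form: `N_χ(T)`, `N_{χ,0}(T)` and the Turing-method reduction -/

/-- `N_χ(T)`: the number of zeros `ρ = β + iγ` of `L(s, χ)` with `0 < β < 1` and `|γ| ≤ T`,
counted with multiplicity — the `finsum` of `DirichletDisc.zeroOrder χ` over the tree's box
`lfunctionZeroBox χ T` (finite for `χ ≠ χ₀`, `lfunctionZeroBox_finite`). Platt 2016 Thm. 3.2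
(`N_χ(t₀)`); Bennett et al. 2021 (1.1) (`N(T, χ)`). [cite: Platt2016GRH, Theorem 3.2] -/
def lfunctionZeroCount (χ : DirichletCharacter ℂ q) (T : ℝ) : ℕ :=
  ∑ᶠ ρ ∈ lfunctionZeroBox χ T, DirichletDisc.zeroOrder χ ρ

/-- `N_{χ,0}(T)`: the number of zeros of `L(s, χ)` on the critical line `Re ρ = 1/2` with
`|Im ρ| ≤ T`, counted with multiplicity. [cite: Platt2016GRH, Theorem 3.2] -/
def lfunctionCriticalZeroCount (χ : DirichletCharacter ℂ q) (T : ℝ) : ℕ :=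
  ∑ᶠ ρ ∈ {ρ ∈ lfunctionZeroBox χ T | ρ.re = 1 / 2}, DirichletDisc.zeroOrder χ ρ

/-- The critical sub-box is contained in the box. [folklore] -/
private theorem lfunctionCriticalZeroSet_subset (χ : DirichletCharacter ℂ q) (T : ℝ) :
    {ρ ∈ lfunctionZeroBox χ T | ρ.re = 1 / 2} ⊆ lfunctionZeroBox χ T :=
  sep_subset _ _

/-- Under GRH for `χ` up to height `T` the critical sub-box is the whole box. [folklore] -/
private theorem lfunctionCriticalZeroSet_eq_of_lfunctionRHUpTo {T : ℝ} (h : LFunctionRHUpTo χ T) :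
    {ρ ∈ lfunctionZeroBox χ T | ρ.re = 1 / 2} = lfunctionZeroBox χ T := by
  refine (lfunctionCriticalZeroSet_subset χ T).antisymm ?_
  intro ρ hρ
  obtain ⟨h0, h1, h2, h3⟩ := mem_lfunctionZeroBox.1 hρ
  exact ⟨hρ, h ρ h0 h1 h2 h3⟩

/-- Multiplicities are positive on the box (`χ ≠ χ₀`): `ρ ∈ lfunctionZeroBox χ T → 0 < m_χ(ρ)`
(`DirichletDisc.zeroOrder_pos_iff`). [folklore] -/
private theorem zeroOrder_pos_of_mem_lfunctionZeroBox (hχ : χ ≠ 1) {T : ℝ} {ρ : ℂ}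
    (h : ρ ∈ lfunctionZeroBox χ T) : 0 < DirichletDisc.zeroOrder χ ρ :=
  (DirichletDisc.zeroOrder_pos_iff χ hχ ρ).2 (mem_lfunctionZeroBox.1 h).1

/-- `N_{χ,0}(T) ≤ N_χ(T)` (`χ ≠ χ₀`): a sub-sum of a finite sum of natural numbers (the zeros on
the line are among the zeros counted by `N_χ`; Platt 2016 Thm. 3.2 / §3).
[cite: Platt2016GRH, Theorem 3.2] -/
theorem lfunctionCriticalZeroCount_le (hχ : χ ≠ 1) (T : ℝ) :
    lfunctionCriticalZeroCount χ T ≤ lfunctionZeroCount χ T := by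
  have hA : (lfunctionZeroBox χ T).Finite := lfunctionZeroBox_finite hχ T
  have hC : {ρ ∈ lfunctionZeroBox χ T | ρ.re = 1 / 2}.Finite := hA.subset (sep_subset _ _)
  unfold lfunctionCriticalZeroCount lfunctionZeroCount
  rw [finsum_mem_eq_finite_toFinset_sum _ hA, finsum_mem_eq_finite_toFinset_sum _ hC]
  exact Finset.sum_le_sum_of_subset
    ((Finite.toFinset_subset_toFinset).2 (lfunctionCriticalZeroSet_subset χ T))

/-- **Turing-method reduction for `L(s, χ)`** (`χ ≠ χ₀`). If `N_χ(T) ≤ N_{χ,0}(T)` — the zeros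
predicted by the zero count have all been found on the critical line — then GRH holds for `χ`
up to height `T`: a zero `s` off the line with `0 < Re s < 1`, `|Im s| ≤ T` lies in the box but
not in the critical sub-box, and all multiplicities on the box are positive, so
`N_{χ,0}(T) < N_χ(T)`. This is the concluding step of every numerical GRH verification
(Rumely 1993 §4; Platt 2016 §3; Bennett et al. 2021 §6.3). [cite: Platt2016GRH, §3] -/
theorem LFunctionRHUpTo.of_zeroCount_le_criticalZeroCount (hχ : χ ≠ 1) {T : ℝ}
    (h : lfunctionZeroCount χ T ≤ lfunctionCriticalZeroCount χ T) : LFunctionRHUpTo χ T := by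
  intro s hs h0 h1 hT
  by_contra hre
  have hA : (lfunctionZeroBox χ T).Finite := lfunctionZeroBox_finite hχ T
  have hC : {ρ ∈ lfunctionZeroBox χ T | ρ.re = 1 / 2}.Finite := hA.subset (sep_subset _ _)
  have hsA : s ∈ lfunctionZeroBox χ T := mem_lfunctionZeroBox.2 ⟨hs, h0, h1, hT⟩
  have hsC : s ∉ {ρ ∈ lfunctionZeroBox χ T | ρ.re = 1 / 2} := fun h' ↦ hre h'.2
  have hlt : lfunctionCriticalZeroCount χ T < lfunctionZeroCount χ T := by
    unfold lfunctionCriticalZeroCount lfunctionZeroCount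
    rw [finsum_mem_eq_finite_toFinset_sum _ hA, finsum_mem_eq_finite_toFinset_sum _ hC]
    exact Finset.sum_lt_sum_of_subset
      ((Finite.toFinset_subset_toFinset).2 (lfunctionCriticalZeroSet_subset χ T))
      (i := s) ((Finite.mem_toFinset hA).2 hsA) (fun h' ↦ hsC ((Finite.mem_toFinset hC).1 h'))
      (zeroOrder_pos_of_mem_lfunctionZeroBox hχ hsA) (fun ρ _ _ ↦ Nat.zero_le _)
  exact lt_irrefl _ (hlt.trans_le h)

/-- `LFunctionRHUpTo χ T ↔ N_{χ,0}(T) = N_χ(T)` (`χ ≠ χ₀`): GRH up to height `T` holds exactly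
when the critical-line count exhausts the zero count (both with multiplicity; Platt 2016 §3).
[cite: Platt2016GRH, §3] -/
theorem lfunctionRHUpTo_iff_criticalZeroCount_eq (hχ : χ ≠ 1) (T : ℝ) :
    LFunctionRHUpTo χ T ↔ lfunctionCriticalZeroCount χ T = lfunctionZeroCount χ T := by
  refine ⟨fun h ↦ ?_, fun h ↦ .of_zeroCount_le_criticalZeroCount hχ h.ge⟩
  unfold lfunctionCriticalZeroCount lfunctionZeroCount
  rw [lfunctionCriticalZeroSet_eq_of_lfunctionRHUpTo h]

/-- **The certificate shape.** A verification for `χ ≠ χ₀` up to height `T` delivers a natural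
number `n` with `N_χ(T) ≤ n` (an upper bound for the zero count: argument principle / Turing's
method at height `±T`) and `n ≤ N_{χ,0}(T)` (at least `n` zeros located on the line: sign changes
of the Hardy function `Z(t, χ)`); then GRH holds for `χ` up to height `T` and both counts equal
`n`. (Platt 2016 §3, §7; Bennett et al. 2021 §6.3.) [cite: Platt2016GRH, §3 and §7] -/
theorem LFunctionRHUpTo.of_count_sandwich (hχ : χ ≠ 1) {T : ℝ} {n : ℕ}
    (h₁ : lfunctionZeroCount χ T ≤ n) (h₂ : n ≤ lfunctionCriticalZeroCount χ T) :
    LFunctionRHUpTo χ T ∧ lfunctionZeroCount χ T = n ∧ lfunctionCriticalZeroCount χ T = n :=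
  ⟨.of_zeroCount_le_criticalZeroCount hχ (h₁.trans h₂),
    le_antisymm h₁ (h₂.trans (lfunctionCriticalZeroCount_le hχ T)),
    le_antisymm (lfunctionCriticalZeroCount_le hχ T |>.trans h₁) h₂⟩

/-! ### Named facts: the verified ranges AS PRINTED -/

/-- Platt's verification height for modulus `q` (Platt 2016, Theorem 7.1, as printed):
`t₀ = max(10⁸/q, 7.5·10⁷/q + 200)` for even `q` and `t₀ = max(10⁸/q, 3.75·10⁷/q + 200)` for odd
`q`. [cite: Platt2016GRH, Theorem 10.1 p. 3026 (journal) = arXiv:1305.3087v1 Theorem 7.1] -/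
def plattHeight (q : ℕ) : ℝ :=
  if Even q then max (10 ^ 8 / (q : ℝ)) (7.5 * 10 ^ 7 / (q : ℝ) + 200)
  else max (10 ^ 8 / (q : ℝ)) (3.75 * 10 ^ 7 / (q : ℝ) + 200)

/-- `10⁸/q ≤ plattHeight q`. [folklore] -/
private theorem div_le_plattHeight (q : ℕ) : 10 ^ 8 / (q : ℝ) ≤ plattHeight q := by
  unfold plattHeight
  split_ifs <;> exact le_max_left _ _

/-- The uniform floor `10⁸/q` is antitone in `q`: `q₁ ≤ q → 10⁸/q ≤ 10⁸/q₁` (`0 < q₁`).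
[folklore] -/
private theorem div_le_div_of_le_level {q₁ q : ℕ} (h0 : 0 < q₁) (h : q₁ ≤ q) :
    10 ^ 8 / (q : ℝ) ≤ 10 ^ 8 / (q₁ : ℝ) :=
  div_le_div_of_nonneg_left (by norm_num) (by exact_mod_cast h0) (by exact_mod_cast h)

/-- **Platt 2016, Theorem 7.1 (as printed): "GRH holds for Dirichlet L-functions of primitive
character modulus `q ≤ 400,000` and to height `t₀ = max(10⁸/q, 7.5·10⁷/q + 200)` for even `q` and
to height `t₀ = max(10⁸/q, 3.75·10⁷/q + 200)` for odd `q`."** Here "GRH holds to height `t₀`" is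
read through the paper's Theorem 3.2: every zero with `Re s ∈ (0, 1)` and `|Im s| ≤ t₀` lies on
`Re s = 1/2`, i.e. `LFunctionRHUpTo χ (plattHeight q)`. The modulus `q = 1` (`L = ζ`) is not
among the "29,565,923,837 Dirichlet L-functions with primitive modulus `q ≤ 400,000`" the
paper checked (§7; that count is `Σ_{2 ≤ q ≤ 400000} #{primitive χ mod q}` exactly), whence the
hypothesis `1 < q`. A ≈400 000-core-hour double-precision interval / MPFI computation (§7);
size XL, no kernel-checkable certificate exists; not discharged here.
[cite: Platt2016GRH, Theorem 10.1 p. 3026 (journal) = arXiv:1305.3087v1 Theorem 7.1] -/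
def platt2016_theorem71 : Prop :=
  ∀ (q : ℕ) [NeZero q], 1 < q → q ≤ 400000 →
    ∀ χ : DirichletCharacter ℂ q, χ.IsPrimitive → LFunctionRHUpTo χ (plattHeight q)

/-- **Bennett–Martin–O'Bryant–Rechnitzer 2021, Lemma 6.1 (a) (as printed): "Let `1 < q < 935`,
suppose that `χ` is a primitive character with conductor `q` … All of the zeros of `L(s, χ)` with
real part between `0` and `1` and imaginary part between `−2(e⁶π − q)/q` and `2(e⁶π − q)/q` have
real part equal to `1/2`."** (A rigorous Arb computation, §6.3: the argument principle from
`3 + iT` plus sign changes of the Hardy `Z`-function; 80 818 characters up to conjugation,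
403 272 zeros.) Not discharged here (size L; a kernel-checkable certificate for a sub-range is
the verify track's Dirichlet STEP-0). [cite: BennettMartinOBryantRechnitzer2021, Lemma 6.1 (a)] -/
def bmor2021_lemma61a : Prop :=
  ∀ (q : ℕ) [NeZero q], 1 < q → q < 935 →
    ∀ χ : DirichletCharacter ℂ q, χ.IsPrimitive →
      LFunctionRHUpTo χ (2 * (Real.exp 6 * Real.pi - q) / q)

/-- **Consequence of Platt 2016, Thm. 7.1, uniform in the character:** for every modulus
`q ≤ 400 000` and every non-principal `χ` mod `q` (so `q > 1`), imprimitive ones included, GRH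
holds for `L(s, χ)` up to height `10⁸/q`: pass to the primitive character `χ⋆` of conductor
`q⋆ ∣ q`, `1 < q⋆ ≤ q` (`lfunctionRHUpTo_iff_primitiveCharacter`), apply the theorem at modulus
`q⋆`, and use `10⁸/q ≤ 10⁸/q⋆ ≤ plattHeight q⋆`.
[cite: Platt2016GRH, Theorem 10.1 p. 3026 (journal) = arXiv:1305.3087v1 Theorem 7.1] -/
theorem grhUpTo_of_platt2016 (hP : platt2016_theorem71) (hq : q ≤ 400000) :
    GRHUpTo q (10 ^ 8 / (q : ℝ)) := by
  intro χ hχ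
  haveI : NeZero χ.conductor := ⟨χ.conductor_ne_zero⟩
  have hc1 : 1 < χ.conductor := one_lt_conductor_of_ne_one hχ
  have hcq : χ.conductor ≤ q :=
    Nat.le_of_dvd (Nat.pos_of_ne_zero (NeZero.ne q)) χ.conductor_dvd_level
  have hprim : LFunctionRHUpTo χ.primitiveCharacter (plattHeight χ.conductor) :=
    hP χ.conductor hc1 (hcq.trans hq) χ.primitiveCharacter χ.primitiveCharacter_isPrimitive
  have hle : 10 ^ 8 / (q : ℝ) ≤ plattHeight χ.conductor :=
    (div_le_div_of_le_level (by omega) hcq).trans (div_le_plattHeight _)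
  exact (lfunctionRHUpTo_iff_primitiveCharacter χ _).2 (hprim.mono_of_le hle)

/-- In particular (Platt 2016, Thm. 7.1): for every `q ≤ 400 000`, GRH mod `q` holds up to height
`250 = 10⁸/400 000`, uniformly in `q` and `χ ≠ χ₀`.
[cite: Platt2016GRH, Theorem 10.1 p. 3026 (journal) = arXiv:1305.3087v1 Theorem 7.1] -/
theorem grhUpTo_250_of_platt2016 (hP : platt2016_theorem71) (hq : q ≤ 400000) :
    GRHUpTo q 250 := by
  intro χ hχ
  refine (grhUpTo_of_platt2016 hP hq χ hχ).mono_of_le ?_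
  have hq' : (q : ℝ) ≤ 400000 := by exact_mod_cast hq
  have hq0 : (0 : ℝ) < q := by exact_mod_cast Nat.pos_of_ne_zero (NeZero.ne q)
  rw [le_div_iff₀ hq0]
  linarith

/-! ### Further printed verifications (appended 2026-08-22)

The as-printed reader of the verify track (rh-explicit-verify-lit, `HOME/verify/lit/BMOR2021-AS-PRINTED.md`)
checked `platt2016_theorem71` and `bmor2021_lemma61a` against the pages: MATCH, with two remarks recorded
here rather than by editing the accepted docstrings: (1) in `bmor2021_lemma61a` the printed "imaginary part
between `−X` and `X`" is rendered as the closed condition `|Im s| ≤ X`; the paper's §6.3 certifies `N(T, χ)` at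
some `T ≥ 2πe⁶/q − 2 = X`, so the closed reading is supported by the method text; (2) "Lemma 6.1" is the
arXiv v1 (2020-05-07) numbering; the journal numbering (Math. Comp. 90 (2021)) was not seen. The counts
`Σ_{2 ≤ q ≤ 400000} #{primitive χ mod q} = 29 565 923 837` and `Σ_{2 ≤ q ≤ 2·10⁶} = 739 151 526 102` printed
by Platt were re-derived exactly (modulus `1` is in neither), whence the hypothesis `1 < q` below as well. -/

/-- **Platt 2016, Theorem 7.2 (as printed): "For every Dirichlet L-function of primitive character
modulus `q ≤ 2,000,000`, we have `L_χ(1/2) ≠ 0`."** The "739,151,526,102 primitive characters with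
`q ≤ 2,000,000`" examined (§7) are exactly those of modulus `2 ≤ q ≤ 2·10⁶`, whence `1 < q` (for
`q = 1`, `ζ(1/2) ≠ 0` holds anyway but is not part of the printed computation). A double-precision
interval / MPFI computation (§7); not discharged here (size XL).
[cite: Platt2016GRH, Theorem 10.2 p. 3026 (journal) = arXiv:1305.3087v1 Theorem 7.2] -/
def platt2016_theorem72 : Prop :=
  ∀ (q : ℕ) [NeZero q], 1 < q → q ≤ 2000000 →
    ∀ χ : DirichletCharacter ℂ q, χ.IsPrimitive → χ.LFunction (1 / 2) ≠ 0

/-- The moduli of Rumely's second range (Math. Comp. 61 (1993), Theorem 4): all `Q ≤ 72`, all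
composite `Q ≤ 112`, and the listed set `{116, 117, 120, 121, 124, 125, 128, 132, 140, 143, 144, 156,
163, 168, 169, 180, 216, 243, 256, 360, 420, 432}`. [cite: Rumely1993ERH, Theorem 4] -/
def rumelyModuli2500 : Set ℕ :=
  {Q | Q ≤ 72} ∪ {Q | Q ≤ 112 ∧ ¬ Q.Prime} ∪
    {116, 117, 120, 121, 124, 125, 128, 132, 140, 143, 144, 156, 163, 168, 169, 180, 216, 243, 256,
      360, 420, 432}

/-- **Rumely 1993, Theorem 4 (as printed, §4 p. 433): "For all `Q ≤ 13`, the ERH holds for all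
primitive Dirichlet L-functions `L(s, χ)` with modulus `Q`, for at least `|t| ≤ 10000`. For all `Q ≤ 72`,
all composite `Q ≤ 112`, and all `Q ∈ {116, 117, 120, 121, 124, 125, 128, 132, 140, 143, 144, 156, 163,
168, 169, 180, 216, 243, 256, 360, 420, 432}`, that is, for the classes of moduli listed in the
introduction, the ERH holds for all primitive `L(s, χ)` with modulus `Q` for at least `|t| ≤ 2500`."**
"ERH for `L(s, χ)` for `|t| ≤ T`" is read, as in the paper's §1 (zeros in the critical strip located on
the line and counted by a generalised Turing criterion), as `LFunctionRHUpTo χ T`; the computation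
concerns moduli `Q > 1` (the conductor-`1` function `ζ` enters only the tables), whence `1 < q`. An
Euler–Maclaurin / interval-arithmetic computation (8087 directed rounding, §2); not discharged here
(size L). (The held scan's OCR prints "`<`" for the paper's "`≤`" in this statement; the bounds are as
in the abstract.) [cite: Rumely1993ERH, Theorem 4] -/
def rumely1993_theorem4 : Prop :=
  (∀ (q : ℕ) [NeZero q], 1 < q → q ≤ 13 →
      ∀ χ : DirichletCharacter ℂ q, χ.IsPrimitive → LFunctionRHUpTo χ 10000) ∧
    ∀ (q : ℕ) [NeZero q], 1 < q → q ∈ rumelyModuli2500 →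
      ∀ χ : DirichletCharacter ℂ q, χ.IsPrimitive → LFunctionRHUpTo χ 2500

/-- Rumely's first range in the modulus-wide form: for `q ≤ 13`, GRH mod `q` (every `χ ≠ χ₀`,
imprimitive ones included) holds up to height `10 000` — the conductor `q⋆` of a non-principal `χ`
mod `q` satisfies `1 < q⋆ ≤ q ≤ 13` (`lfunctionRHUpTo_iff_primitiveCharacter`).
[cite: Rumely1993ERH, Theorem 4] -/
theorem grhUpTo_10000_of_rumely1993 (hR : rumely1993_theorem4) (hq : q ≤ 13) : GRHUpTo q 10000 := by
  intro χ hχ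
  haveI : NeZero χ.conductor := ⟨χ.conductor_ne_zero⟩
  have hc1 : 1 < χ.conductor := one_lt_conductor_of_ne_one hχ
  have hcq : χ.conductor ≤ q :=
    Nat.le_of_dvd (Nat.pos_of_ne_zero (NeZero.ne q)) χ.conductor_dvd_level
  exact (lfunctionRHUpTo_iff_primitiveCharacter χ _).2
    (hR.1 χ.conductor hc1 (hcq.trans hq) χ.primitiveCharacter χ.primitiveCharacter_isPrimitive)

/-- Platt's Theorem 7.2 transferred to every non-principal `χ` mod `q ≤ 2·10⁶`, imprimitive ones
included (`L(1/2, χ) = 0 ↔ L(1/2, χ⋆) = 0`, `DirichletCharacter.LFunction_eq_zero_iff_primitiveCharacter`;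
`1 < q⋆ ≤ q`).
[cite: Platt2016GRH, Theorem 10.2 p. 3026 (journal) = arXiv:1305.3087v1 Theorem 7.2] -/
theorem LFunction_one_half_ne_zero_of_platt2016 (hP : platt2016_theorem72) (hq : q ≤ 2000000)
    {χ : DirichletCharacter ℂ q} (hχ : χ ≠ 1) : χ.LFunction (1 / 2) ≠ 0 := by
  haveI : NeZero χ.conductor := ⟨χ.conductor_ne_zero⟩
  have hc1 : 1 < χ.conductor := one_lt_conductor_of_ne_one hχ
  have hcq : χ.conductor ≤ q :=
    Nat.le_of_dvd (Nat.pos_of_ne_zero (NeZero.ne q)) χ.conductor_dvd_level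
  have hprim := hP χ.conductor hc1 (hcq.trans hq) χ.primitiveCharacter χ.primitiveCharacter_isPrimitive
  intro h0
  refine hprim ((χ.LFunction_eq_zero_iff_primitiveCharacter (s := 1 / 2) ?_ ?_).1 h0)
  · norm_num
  · norm_num

/-! ### The `ζ` bridge and Rumely as a corollary of Platt (appended 2026-08-22, verify-lead VL-10) -/

/-- **Modulus-`1` bridge.** For the (trivial, primitive) character mod `1`, `L(s, 1) = ζ(s)`
(Mathlib `DirichletCharacter.LFunction_modOne_eq`), and GRH for it up to height `T` in the two-sided
sense of this file is the tree's `RiemannHypothesisUpTo T` (`NamedHypotheses.lean`; one-sided,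
`0 < Im s ≤ T`): the lower half follows by conjugation (`RiemannHypothesisUpTo.re_eq_of_im_neg`),
real zeros in `(0, 1)` do not exist (`riemannZeta_ne_zero_of_im_eq_zero_of_pos_of_lt_one`, Titchmarsh
§2.12), and a zero with `Im s ≠ 0` lies in the open strip (`riemannZeta_eq_zero_iff_of_re_nonpos`,
`riemannZeta_ne_zero_of_one_le_re`). So the `ζ` rows (`riemannHypothesisUpTo_sixteen`, `…_2516`,
`riemannHypothesisUpTo_platt_trudgian`) and the `L` rows share one vocabulary.
[cite: Titchmarsh1986, §2.12 (text after (2.12.4))] -/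
theorem lfunctionRHUpTo_one_iff (T : ℝ) :
    LFunctionRHUpTo (1 : DirichletCharacter ℂ 1) T ↔ DiophantineGeometry.RiemannHypothesisUpTo T := by
  constructor
  · intro h s hs him hT
    have hre1 : s.re < 1 := not_le.1 fun hle ↦ riemannZeta_ne_zero_of_one_le_re hle hs
    have hre0 : 0 < s.re := by
      by_contra hle
      obtain ⟨n, hn⟩ := (riemannZeta_eq_zero_iff_of_re_nonpos (not_lt.1 hle)).1 hs
      rw [hn] at him
      simp at him
    refine h s ?_ hre0 hre1 ?_
    · rwa [DirichletCharacter.LFunction_modOne_eq]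
    · rwa [abs_of_pos him]
  · intro h s hs h0 h1 hT
    rw [DirichletCharacter.LFunction_modOne_eq] at hs
    rcases lt_trichotomy s.im 0 with him | him | him
    · exact h.re_eq_of_im_neg hs him (by rwa [abs_of_neg him] at hT)
    · exact absurd hs (riemannZeta_ne_zero_of_im_eq_zero_of_pos_of_lt_one him h0 h1)
    · exact h s hs him (by rwa [abs_of_pos him] at hT)

/-- The `ζ` instance carried over: RH up to Platt–Trudgian's height, read as GRH for the character
mod `1` up to height `3 000 175 332 800` (from the named fact `riemannHypothesisUpTo_platt_trudgian`).
[cite: PlattTrudgianBLMS2021, Theorem 1] -/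
theorem lfunctionRHUpTo_one_platt_trudgian (h : DiophantineGeometry.riemannHypothesisUpTo_platt_trudgian) :
    LFunctionRHUpTo (1 : DirichletCharacter ℂ 1) 3000175332800 :=
  (lfunctionRHUpTo_one_iff _).2 h

/-- A Rumely modulus of the second range is at most `432`. [cite: Rumely1993ERH, Theorem 4] -/
private theorem le_432_of_mem_rumelyModuli2500 {Q : ℕ} (h : Q ∈ rumelyModuli2500) : Q ≤ 432 := by
  simp only [rumelyModuli2500, Set.mem_union, Set.mem_setOf_eq, Set.mem_insert_iff,
    Set.mem_singleton_iff] at h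
  omega

/-- **Rumely 1993, Theorem 4, as a COROLLARY of Platt 2016, Theorem 7.1** (verify-lead VL-10 (ii)):
every modulus in Rumely's statement is `≤ 432 ≤ 400 000`, and Platt's height there is at least
`10⁸/q ≥ 10⁸/13 > 10 000` resp. `≥ 10⁸/432 > 2 500`; so the printed 1993 statement (typed verbatim as
the named fact `rumely1993_theorem4`) follows from `platt2016_theorem71` — it adds no independent
debt beyond Platt's computation. [cite: Rumely1993ERH, Theorem 4] -/
theorem rumely1993_theorem4_of_platt2016 (hP : platt2016_theorem71) : rumely1993_theorem4 := by
  refine ⟨fun q _ hq1 hq χ hχ ↦ ?_, fun q _ hq1 hq χ hχ ↦ ?_⟩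
  · have hq' : q ≤ 400000 := by omega
    have hq0 : (0 : ℝ) < q := by exact_mod_cast (show 0 < q by omega)
    have hqR : (q : ℝ) ≤ 13 := by exact_mod_cast hq
    refine (hP q hq1 hq' χ hχ).mono_of_le (le_trans ?_ (div_le_plattHeight q))
    rw [le_div_iff₀ hq0]
    nlinarith
  · have h432 : q ≤ 432 := le_432_of_mem_rumelyModuli2500 hq
    have hq' : q ≤ 400000 := by omega
    have hq0 : (0 : ℝ) < q := by exact_mod_cast (show 0 < q by omega)
    have hqR : (q : ℝ) ≤ 432 := by exact_mod_cast h432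
    refine (hP q hq1 hq' χ hχ).mono_of_le (le_trans ?_ (div_le_plattHeight q))
    rw [le_div_iff₀ hq0]
    nlinarith

end Literature.NumberTheory.LFunctions

end
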